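import Mathlib
import HarnessLib.Audit
import Summits.PneNP.PneNP.Theorems.PstarGapLemma

/-!
# The two-query rung for reader families (ROUND-24, item T24.19)

FRONTIER range-avoidance ladder, rung F-N3, ROUND 24 (cell `pnp-ideate`, planner seat p3; restricted-model proof complexity —
nothing here bears on `P` versus `NP`).

After `GapOneAll` (T24.17: one parity never creates a minimal infeasible set) the crux `PstarGapLemma.PstarGapLemmaSO` lives at
`|W| ≥ 2`, where the degree bound enters: the reader star (`Δ` readers on one centre, `W = {a_q = 0, Σ tips}`) and the `K_{Δ,Δ}`
cluster (`Δ²` readers, `W = {Σ_P a = 0, Σ tips}`) are minimal infeasible with `|W| = 2` (memo ROUND-24-PRESEED §13 R10(q)).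
`GapTwoReaders` (T24.19, paper-proved in memo R10(t)) is the matching upper bound for READER families — every output of `J` has both
XOR slots `J`-private — : `|J| ≤ 64·Δ²`.  Proof: substituting the readers turns the two parities into quadratics
`f_i = L_i + Σ_{M_i} a_p a_q` in the AND variables (`M_i` = AND pairs of the readers read by constraint `i`; simple overlaps make the
edges distinct, `MaxDegree Δ` bounds the degree of the graph `M_1 ∪ M_2`); infeasibility `V(f_1) ⊆ {f_2 = 1}` and the Fourier-bias
identity `β_2 + β_{12} = −(1 + β_1)` (`|β| ≤ 2^{-rank/2}` for quadratics) force `rank Q_1, rank Q_2 ≤ 6`; a graph of `𝔽₂`-adjacency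
rank `≤ 2k` and maximum degree `Δ` has `≤ 2^{2k}` twin classes of size `≤ Δ`, hence `≤ 2^{2k-1} Δ²` edges.  FRONTIER.
-/

set_option linter.dupNamespace false

open Finset Literature.Computability.Complexity
open Summit.PneNP.PneNP.Theorems.PstarTyped (Typed)
open Summit.PneNP.PneNP.Theorems.PstarSALevel (varSet BoundaryExpanding SimpleOverlap)
open Summit.PneNP.PneNP.Theorems.PstarGapLemma (MinInfeasible MaxDegree)

namespace Summit.PneNP.PneNP.Theorems.PstarGapTwoReaders

variable {n m : ℕ}

/-- `j ∈ J` is a READER of `J`: each of its XOR slots (slots `0, 1`) occurs in no other output of `J`. -/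
def IsReader (I : LocalMap 4 n m) (J : Finset (Fin m)) (j : Fin m) : Prop :=
  ∀ s : Fin 4, s.val < 2 → ∀ j' ∈ J, j' ≠ j → I.vars j s ∉ varSet I j'

/-- **T24.19 — the two-query rung for reader families (paper-proved, memo §13 R10(t)).**  Under two parity constraints a minimal
infeasible set consisting of readers has at most `64·Δ²` outputs.  FRONTIER. -/
@[conjecture] def GapTwoReaders : Prop :=
  ∀ (Δ n m r : ℕ) (I : LocalMap 4 n m), I.IsPure xorAndPred → Typed I → BoundaryExpanding r I → SimpleOverlap I →
    MaxDegree Δ I → ∀ (y : Fin m → Bool) (W : Finset (Finset (Fin n) × Bool)) (J : Finset (Fin m)),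
      W.card ≤ 2 → J.card ≤ r → (∀ j ∈ J, IsReader I J j) → MinInfeasible I y W J → J.card ≤ 64 * Δ ^ 2

end Summit.PneNP.PneNP.Theorems.PstarGapTwoReaders
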